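import Literature.Probability.LatticeModels.CoarseCellMixingRecursion
import HarnessLib

/-!
# Exponential decay of boundary influence with a quasi-local leak (defect-free case)

Sixth companion ("theorems only") file of
`Literature/Probability/LatticeModels/CoarseCellFiniteSize.lean`: the Dobrushin–Shlosman block
recursion of `CoarseCellMixingDecay.lean` for a specification that is NOT of finite range but has
an exponentially small leak `HasLeak cell γ n Λl r` (exterior changes at cell distance `> 2n+1+m`
move central expectations of cube kernels by `≤ Λl e^{-rm}`), in the defect-free case (no bad
configurations). The single-radius recursion of the finite-range case is replaced by the weighted
(Dobrushin interdependence-matrix) form: the block expectation `σ ↦ γ_A g(σ)` is telescoped over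
the annuli `2n+1 ≤ cdist ≤ 2n+1+m`, the `m`-th increment having sup norm `≤ Λl e^{-r(m-1)}` and
depending on `≤ (4n+3+2m)^d` cells, and the resulting linear recursion
`Φ(R) ≤ ε·sc·Φ(R-2n-1) + Σ_m 2Λl e^{-r(m-1)} (4n+3+2m)^d Φ(R-2n-1-m) + 2Λl e^{-r(R-2n-1)}`
is solved by `Φ(R) = e^{κ(2n+1)} e^{-κR}` under the subcriticality condition
`e^{κ(2n+1)} (ε·shellCount d n + 2 Λl e^{r} K) + 2 Λl ≤ 1`, `K` a bound for the annulus sums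
`Σ_{j<M} (4n+5+2j)^d e^{-(r-κ)(j+1)}` (finite for `κ < r`).

* `influence_decay_leak` — the decay theorem (the chain rule for observables of sup norm `≤ λ`,
  `multiCell_influence_of_abs_le`, is in `CoarseCellMixingRecursion.lean`).

## References

* R. L. Dobrushin, S. B. Shlosman, *Constructive criterion for the uniqueness of Gibbs field*
  (1985), §2; *Completely analytical Gibbs fields* (1985), the comparison theorem.
* H.-O. Georgii, *Gibbs Measures and Phase Transitions*, 2nd ed. (de Gruyter 2011), §8.1–8.2
  (Dobrushin's interdependence matrix with exponential weights, Thm. 8.20 / Cor. 8.32).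
-/

noncomputable section

open _root_.MeasureTheory
open scoped ENNReal

namespace Literature.Probability.LatticeModels

variable {d : ℕ} {μc : Fin d → ℕ} {V S : Type*} [MeasurableSpace S]

/-- **Exponential decay of boundary influence with a leak (defect-free case).** Let `γ` satisfy
the good-exterior finite-size condition at `(n, ε)` with NO bad configurations and the leak profile
`HasLeak cell γ n Λl r` on a coarse torus with `≥ 4n+3` cells per side, and let `0 ≤ κ ≤ r` and `K`
satisfy the subcriticality condition
`e^{κ(2n+1)} (ε · shellCount d n + 2 Λl e^{r} K) + 2 Λl ≤ 1`, `K` bounding the annulus sums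
`Σ_{j<M} (4n+5+2j)^d e^{-(r-κ)(j+1)}`. If two boundary conditions agree off `Λ` on the ball of radius
`R` around `x`, then for every `[0,1]`-valued cell-`x`-local `g`,
`|γ_Λ g(ζ) - γ_Λ g(ζ')| ≤ e^{κ(2n+1)} e^{-κ R}`. Proof: strong induction on `R`; resample the block
`A = Λ ∩ cube(x, 2n)` and telescope `σ ↦ γ_A g(σ)` over the annuli `2n+1 ≤ cdist ≤ 2n+1+m`
(`m ≤ R-2n-1`): the `0`-th term oscillates by `≤ ε` (finite-size condition) and depends on the
`≤ shellCount d n` shell cells, the `m`-th increment has sup norm `≤ Λl e^{-r(m-1)}` (leak) and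
depends on `≤ (4n+3+2m)^d` cells, the remainder is `≤ Λl e^{-r(R-2n-1)}` on the relevant
configurations; each term is bounded by the chain rule and the induction hypothesis at the reduced
radius. [cite: DobrushinShlosman1985, §2] -/
theorem influence_decay_leak [Fintype V] {cell : V → CoarseIdx μc}
    {γ : Specification V S} (hγ : IsSpecification γ) {good : CoarseIdx μc → Set (V → S)}
    {n : ℕ} {ε Λl r κ K : ℝ} (hε : 0 ≤ ε) (hFS : IsGoodFS cell γ good n ε)
    (hall : ∀ c σ, σ ∈ good c) (hΛl : 0 ≤ Λl) (hleak : HasLeak cell γ n Λl r)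
    (hμ : ∀ i, 4 * n + 3 ≤ μc i + 1) (hκ : 0 ≤ κ) (hκr : κ ≤ r)
    (hK : ∀ M : ℕ, ∑ j ∈ Finset.range M,
      ((4 * n + 5 + 2 * j) ^ d : ℝ) * Real.exp (-((r - κ) * (j + 1))) ≤ K)
    (hsub : Real.exp (κ * (2 * n + 1)) * (ε * shellCount d n + 2 * Λl * Real.exp r * K) +
      2 * Λl ≤ 1)
    (R : ℕ) :
    ∀ (Λ : Finset V), (∀ v w, cell v = cell w → v ∈ Λ → w ∈ Λ) →
      ∀ (x : CoarseIdx μc) (g : (V → S) → ℝ), Measurable g → (∀ σ, 0 ≤ g σ ∧ g σ ≤ 1) →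
      DependsOn g {v | cell v = x} →
      ∀ ζ ζ' : V → S, (∀ v, v ∉ Λ → cdist x (cell v) ≤ R → ζ v = ζ' v) →
        |∫ σ, g σ ∂(γ Λ ζ) - ∫ σ, g σ ∂(γ Λ ζ')| ≤
          Real.exp (κ * (2 * n + 1)) * Real.exp (-(κ * R)) := by
  classical
  refine Nat.strong_induction_on R fun R IH => ?_
  intro Λ hΛ x g hgm hg01 hgdep ζ ζ' hagree
  haveI := hγ.isProbability Λ ζ
  haveI := hγ.isProbability Λ ζ'
  set E : ℝ := Real.exp (κ * (2 * n + 1)) with hE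
  set B : ℝ := E * Real.exp (-(κ * R)) with hB
  have hg1 : ∀ σ, |g σ| ≤ 1 := fun σ => by rw [abs_of_nonneg (hg01 σ).1]; exact (hg01 σ).2
  -- the trivial bound `1`
  have htriv : |∫ σ, g σ ∂(γ Λ ζ) - ∫ σ, g σ ∂(γ Λ ζ')| ≤ 1 := by
    obtain ⟨a0, a1⟩ := integral_mem_unitInterval (μ := γ Λ ζ) hgm hg01
    obtain ⟨b0, b1⟩ := integral_mem_unitInterval (μ := γ Λ ζ') hgm hg01
    rw [abs_sub_le_iff]; constructor <;> linarith
  by_cases hRsmall : R < 2 * n + 1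
  · -- small radius: the bound is `≥ 1`
    refine htriv.trans ?_
    rw [hB, hE, ← Real.exp_add]
    apply Real.one_le_exp
    have hRle : (R : ℝ) ≤ 2 * n + 1 := by exact_mod_cast hRsmall.le
    nlinarith
  push Not at hRsmall
  -- `R = 2n+1+M`
  set M : ℕ := R - (2 * n + 1) with hM
  have hRM : R = 2 * n + 1 + M := by omega
  -- the block `A = Λ ∩ cube(x, 2n)`
  set A : Finset V := Λ.filter fun v => cdist x (cell v) ≤ 2 * n with hA
  have hAΛ : A ⊆ Λ := Finset.filter_subset _ _
  have hAcube : ∀ v ∈ A, cdist x (cell v) ≤ 2 * n := fun v hv => (Finset.mem_filter.1 hv).2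
  have hAunion : ∀ v w, cell v = cell w → v ∈ A → w ∈ A := fun v w hvw hv => by
    rw [hA, Finset.mem_filter] at hv ⊢
    exact ⟨hΛ v w hvw hv.1, hvw ▸ hv.2⟩
  -- annuli, projections, truncated block expectations
  let Y : ℕ → Finset (CoarseIdx μc) := fun m =>
    Finset.univ.filter fun c => 2 * n + 1 ≤ cdist x c ∧ cdist x c ≤ 2 * n + 1 + m
  let P : ℕ → (V → S) → (V → S) := fun m σ v =>
    if v ∈ Λ ∧ 2 * n + 1 ≤ cdist x (cell v) ∧ cdist x (cell v) ≤ 2 * n + 1 + m then σ v else ζ v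
  let Hf : ℕ → (V → S) → ℝ := fun m σ => ∫ τ, g τ ∂(γ A (P m σ))
  have hPm : ∀ m, Measurable (P m) := fun m => by
    refine measurable_pi_iff.2 fun v => ?_
    by_cases hv : v ∈ Λ ∧ 2 * n + 1 ≤ cdist x (cell v) ∧ cdist x (cell v) ≤ 2 * n + 1 + m
    · simp only [P, hv, and_self, if_true]; exact measurable_pi_apply v
    · simp only [P, hv, if_false]; exact measurable_const
  have hHm : ∀ m, Measurable (Hf m) := fun m =>
    (DobrushinShlosman.measurable_windowAvg' hγ A hgm).comp (hPm m)
  have hH01 : ∀ m σ, 0 ≤ Hf m σ ∧ Hf m σ ≤ 1 := fun m σ => by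
    haveI := hγ.isProbability A (P m σ)
    exact integral_mem_unitInterval hgm hg01
  have hH1 : ∀ m σ, |Hf m σ| ≤ 1 := fun m σ => by
    rw [abs_of_nonneg (hH01 m σ).1]; exact (hH01 m σ).2
  have hHi : ∀ m η, Integrable (Hf m) (γ Λ η) := fun m η => by
    haveI := hγ.isProbability Λ η
    exact DobrushinMetric.integrable_of_abs_le' (hHm m) (hH1 m)
  have hHdep : ∀ m, DependsOn (Hf m) {v | cell v ∈ Y m} := by
    intro m σ σ' h
    simp only [Hf]
    have hP : P m σ = P m σ' := funext fun v => by
      by_cases hc : v ∈ Λ ∧ 2 * n + 1 ≤ cdist x (cell v) ∧ cdist x (cell v) ≤ 2 * n + 1 + m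
      · simp only [P, hc, and_self, if_true]
        exact h v (by
          show cell v ∈ Y m
          simp only [Y, Finset.mem_filter]
          exact ⟨Finset.mem_univ _, hc.2.1, hc.2.2⟩)
      · simp only [P, hc, if_false]
    rw [hP]
  have hYcard : ∀ m, ((Y m).card : ℝ) ≤ ((4 * n + 3 + 2 * m) ^ d : ℕ) := by
    intro m
    have h1 : (Y m).card ≤ (Finset.univ.filter fun c : CoarseIdx μc =>
        cdist x c ≤ 2 * n + 1 + m).card :=
      Finset.card_le_card fun c hc => by
        simp only [Y, Finset.mem_filter] at hc
        exact Finset.mem_filter.2 ⟨Finset.mem_univ _, hc.2.2⟩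
    have h2 := card_filter_cdist_le x (2 * n + 1 + m)
    have e : 2 * (2 * n + 1 + m) + 1 = 4 * n + 3 + 2 * m := by ring
    rw [e] at h2
    exact_mod_cast h1.trans h2
  have hY0card : ((Y 0).card : ℝ) ≤ shellCount d n := by
    have h1 : (Y 0).card ≤ (Finset.univ.filter fun c : CoarseIdx μc =>
        cdist x c = 2 * n + 1).card :=
      Finset.card_le_card fun c hc => by
        simp only [Y, Finset.mem_filter] at hc
        exact Finset.mem_filter.2 ⟨Finset.mem_univ _, by omega⟩
    exact_mod_cast h1.trans (card_shell_le_shellCount x n hμ)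
  -- leak: consecutive truncations are close, uniformly
  have hincr : ∀ m σ, |Hf (m + 1) σ - Hf m σ| ≤ Λl * Real.exp (-(r * m)) := by
    intro m σ
    rw [abs_sub_comm]
    refine hleak x A hAcube hAunion m (P m σ) (P (m + 1) σ) (fun v hd => ?_) g hgm hg01 hgdep
    by_cases hc : v ∈ Λ ∧ 2 * n + 1 ≤ cdist x (cell v) ∧ cdist x (cell v) ≤ 2 * n + 1 + m
    · have hc' : v ∈ Λ ∧ 2 * n + 1 ≤ cdist x (cell v) ∧ cdist x (cell v) ≤ 2 * n + 1 + (m + 1) :=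
        ⟨hc.1, hc.2.1, by omega⟩
      simp only [P, hc, hc', and_self, if_true]
    · have hc' : ¬ (v ∈ Λ ∧ 2 * n + 1 ≤ cdist x (cell v) ∧
          cdist x (cell v) ≤ 2 * n + 1 + (m + 1)) := fun h => hc ⟨h.1, h.2.1, by omega⟩
      simp only [P, hc, hc', if_false]
  -- leak: the last truncation is close to the block expectation on the relevant configurations
  have htail : ∀ σ : V → S, (∀ v, v ∉ Λ → cdist x (cell v) ≤ 2 * n + 1 + M → σ v = ζ v) →
      |∫ τ, g τ ∂(γ A σ) - Hf M σ| ≤ Λl * Real.exp (-(r * M)) := by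
    intro σ hσ
    let σh : V → S := fun v => if v ∈ A then ζ v else σ v
    have e1 : γ A σ = γ A σh :=
      DobrushinShlosman.spec_apply_congr hγ A fun v hv => by simp only [σh, hv, if_false]
    rw [e1]
    refine hleak x A hAcube hAunion M σh (P M σ) (fun v hd => ?_) g hgm hg01 hgdep
    by_cases hvA : v ∈ A
    · have hc : ¬ (v ∈ Λ ∧ 2 * n + 1 ≤ cdist x (cell v) ∧ cdist x (cell v) ≤ 2 * n + 1 + M) :=
        fun h => by have := hAcube v hvA; omega
      simp only [σh, P, hvA, hc, if_true, if_false]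
    · by_cases hvΛ : v ∈ Λ
      · have hgt : ¬ cdist x (cell v) ≤ 2 * n := fun hle => hvA (Finset.mem_filter.2 ⟨hvΛ, hle⟩)
        have hc : v ∈ Λ ∧ 2 * n + 1 ≤ cdist x (cell v) ∧ cdist x (cell v) ≤ 2 * n + 1 + M :=
          ⟨hvΛ, by omega, hd⟩
        simp only [σh, P, hvA, hc, and_self, if_true, if_false]
      · have hc : ¬ (v ∈ Λ ∧ 2 * n + 1 ≤ cdist x (cell v) ∧ cdist x (cell v) ≤ 2 * n + 1 + M) :=
          fun h => hvΛ h.1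
        simp only [σh, P, hvA, hc, if_false]
        exact hσ v hvΛ hd
  -- finite-size condition: the `0`-th truncation oscillates by at most `ε`
  have hosc0 : ∀ σ₁ σ₂, |Hf 0 σ₁ - Hf 0 σ₂| ≤ ε := by
    intro σ₁ σ₂
    refine hFS.fs x A hAcube hAunion (P 0 σ₁) (P 0 σ₂) (fun v hv => ?_)
      (fun c' _ _ => ⟨hall _ _, hall _ _⟩) g hgm hg01 hgdep
    have hc : ¬ (v ∈ Λ ∧ 2 * n + 1 ≤ cdist x (cell v) ∧ cdist x (cell v) ≤ 2 * n + 1 + 0) :=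
      fun h => by omega
    simp only [P, hc, if_false]
  -- resampling inside the outer kernels and the tail error
  have hcons : ∀ η, ∫ σ, g σ ∂(γ Λ η) = ∫ σ, (∫ τ, g τ ∂(γ A σ)) ∂(γ Λ η) := fun η =>
    (kernel_integral_integral_eq_of_subset hγ hAΛ η hgm hg1).symm
  have houter : ∀ η : V → S, (∀ v, v ∉ Λ → cdist x (cell v) ≤ 2 * n + 1 + M → η v = ζ v) →
      |∫ σ, g σ ∂(γ Λ η) - ∫ σ, Hf M σ ∂(γ Λ η)| ≤ Λl * Real.exp (-(r * M)) := by
    intro η hη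
    haveI := hγ.isProbability Λ η
    have hKi : Integrable (fun σ => ∫ τ, g τ ∂(γ A σ)) (γ Λ η) :=
      DobrushinMetric.integrable_of_abs_le' (DobrushinShlosman.measurable_windowAvg' hγ A hgm)
        (DobrushinShlosman.abs_windowAvg_le' hγ A hg1)
    rw [hcons η, ← integral_sub hKi (hHi M η)]
    have h := norm_integral_le_of_norm_le_const (μ := γ Λ η) (C := Λl * Real.exp (-(r * M)))
      (f := fun σ => (∫ τ, g τ ∂(γ A σ)) - Hf M σ) ?_
    · simpa using h
    · filter_upwards [hγ.proper Λ η] with σ hσ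
      rw [Real.norm_eq_abs]
      exact htail σ fun v hv hd => by rw [hσ v hv]; exact hη v hv hd
  -- the induction hypothesis at the reduced radii, in the form consumed by the chain rule
  have hIH : ∀ m, m ≤ M → ∀ (Λ' : Finset V), (∀ v w, cell v = cell w → v ∈ Λ' → w ∈ Λ') →
      ∀ (y : CoarseIdx μc) (g' : (V → S) → ℝ), Measurable g' → (∀ σ, 0 ≤ g' σ ∧ g' σ ≤ 1) →
      DependsOn g' {v | cell v = y} →
      ∀ η η' : V → S, (∀ v, v ∉ Λ' → cdist y (cell v) ≤ R - (2 * n + 1) - m → η v = η' v) →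
        |∫ σ, g' σ ∂(γ Λ' η) - ∫ σ, g' σ ∂(γ Λ' η')| ≤
          E * Real.exp (-(κ * ((R - (2 * n + 1) - m : ℕ) : ℝ))) :=
    fun m _ => IH (R - (2 * n + 1) - m) (by omega)
  have hagreeY : ∀ m, m ≤ M → ∀ y ∈ Y m, ∀ v, v ∉ Λ →
      cdist y (cell v) ≤ R - (2 * n + 1) - m → ζ v = ζ' v := by
    intro m hm y hy v hv hd
    apply hagree v hv
    have hxy : cdist x y ≤ 2 * n + 1 + m := by
      simp only [Y, Finset.mem_filter] at hy
      exact hy.2.2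
    have ht := cdist_triangle x y (cell v)
    omega
  -- the `0`-th term: finite-size contraction times the shell influence
  have hstep0 : |∫ σ, Hf 0 σ ∂(γ Λ ζ) - ∫ σ, Hf 0 σ ∂(γ Λ ζ')| ≤
      ε * shellCount d n * (E * Real.exp (-(κ * ((R - (2 * n + 1) - 0 : ℕ) : ℝ)))) := by
    set Φ₀ : ℝ := E * Real.exp (-(κ * ((R - (2 * n + 1) - 0 : ℕ) : ℝ))) with hΦ₀
    have hΦ₀nn : 0 ≤ Φ₀ := by positivity
    have hRHS : 0 ≤ ε * shellCount d n * Φ₀ := by positivity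
    rcases hε.eq_or_lt with hε0 | hεpos
    · have hc : ∀ σ, Hf 0 σ = Hf 0 ζ := fun σ => by
        have h := hosc0 σ ζ
        rw [← hε0] at h
        exact sub_eq_zero.1 (abs_nonpos_iff.1 h)
      have hH : Hf 0 = fun _ => Hf 0 ζ := funext hc
      rw [hH]
      simp only [integral_const, probReal_univ, smul_eq_mul, one_mul, sub_self, abs_zero]
      exact hRHS
    · haveI : Nonempty (V → S) := ⟨ζ⟩
      set lo : ℝ := ⨅ σ, Hf 0 σ with hlo
      have hbdd : BddBelow (Set.range (Hf 0)) := ⟨0, by rintro _ ⟨σ, rfl⟩; exact (hH01 0 σ).1⟩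
      have hlo1 : ∀ σ, lo ≤ Hf 0 σ := fun σ => ciInf_le hbdd σ
      have hlo2 : ∀ σ, Hf 0 σ ≤ lo + ε := fun σ => by
        have h : Hf 0 σ - ε ≤ lo := le_ciInf fun σ₂ => by
          have h2 := abs_sub_le_iff.1 (hosc0 σ σ₂)
          linarith [h2.1]
        linarith
      set Ht : (V → S) → ℝ := fun σ => (Hf 0 σ - lo) / ε with hHt
      have hHtm : Measurable Ht := ((hHm 0).sub_const lo).div_const ε
      have hHt01 : ∀ σ, 0 ≤ Ht σ ∧ Ht σ ≤ 1 := fun σ =>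
        ⟨div_nonneg (by linarith [hlo1 σ]) hε, (div_le_one hεpos).2 (by linarith [hlo2 σ])⟩
      have hHtdep : DependsOn Ht {v | cell v ∈ Y 0} := fun σ σ' h => by
        simp only [hHt, hHdep 0 h]
      have hMC := multiCell_influence hγ (ρ := R - (2 * n + 1) - 0) (δ := Φ₀) (hIH 0 (by omega))
        (Y 0) Λ hΛ Ht hHtm hHt01 hHtdep ζ ζ' (hagreeY 0 (by omega))
      have hHti : ∀ η, Integrable Ht (γ Λ η) := fun η => by
        haveI := hγ.isProbability Λ η
        exact DobrushinMetric.integrable_of_abs_le' hHtm (M := 1) fun σ => by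
          rw [abs_of_nonneg (hHt01 σ).1]; exact (hHt01 σ).2
      have hlin : ∀ η : V → S, ∫ σ, Hf 0 σ ∂(γ Λ η) = lo + ε * ∫ σ, Ht σ ∂(γ Λ η) := by
        intro η
        haveI := hγ.isProbability Λ η
        have hH : Hf 0 = fun σ => lo + ε * Ht σ := funext fun σ => by
          simp only [hHt]; field_simp; ring
        rw [hH, integral_add (integrable_const lo) ((hHti η).const_mul ε), integral_const,
          integral_const_mul]
        simp
      rw [hlin ζ, hlin ζ']
      calc |lo + ε * ∫ σ, Ht σ ∂(γ Λ ζ) - (lo + ε * ∫ σ, Ht σ ∂(γ Λ ζ'))|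
          = ε * |∫ σ, Ht σ ∂(γ Λ ζ) - ∫ σ, Ht σ ∂(γ Λ ζ')| := by
            rw [add_sub_add_left_eq_sub, ← mul_sub, abs_mul, abs_of_pos hεpos]
        _ ≤ ε * ((Y 0).card * Φ₀) := mul_le_mul_of_nonneg_left hMC hε
        _ ≤ ε * (shellCount d n * Φ₀) := by gcongr
        _ = ε * shellCount d n * Φ₀ := by ring
  -- the `m`-th increments: leak size times the annulus influence
  have hstepm : ∀ m, m < M →
      |∫ σ, (Hf (m + 1) σ - Hf m σ) ∂(γ Λ ζ) - ∫ σ, (Hf (m + 1) σ - Hf m σ) ∂(γ Λ ζ')| ≤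
        2 * (Λl * Real.exp (-(r * m))) * ((Y (m + 1)).card *
          (E * Real.exp (-(κ * ((R - (2 * n + 1) - (m + 1) : ℕ) : ℝ))))) := by
    intro m hm
    refine multiCell_influence_of_abs_le hγ (hIH (m + 1) (by omega)) (Y (m + 1)) Λ hΛ
      (fun σ => Hf (m + 1) σ - Hf m σ) ((hHm (m + 1)).sub (hHm m)) (hincr m) ?_ ζ ζ'
      (hagreeY (m + 1) (by omega))
    intro σ σ' h
    have hsub' : {v | cell v ∈ Y m} ⊆ {v | cell v ∈ Y (m + 1)} := fun v hv => by
      simp only [Y, Set.mem_setOf_eq, Finset.mem_filter] at hv ⊢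
      exact ⟨hv.1, hv.2.1, by omega⟩
    simp only [hHdep (m + 1) h, hHdep m fun v hv => h v (hsub' hv)]
  -- telescoping over the annuli
  have htele : ∀ m, m ≤ M → |∫ σ, Hf m σ ∂(γ Λ ζ) - ∫ σ, Hf m σ ∂(γ Λ ζ')| ≤
      ε * shellCount d n * (E * Real.exp (-(κ * ((R - (2 * n + 1) - 0 : ℕ) : ℝ)))) +
      ∑ j ∈ Finset.range m, 2 * (Λl * Real.exp (-(r * j))) * ((Y (j + 1)).card *
          (E * Real.exp (-(κ * ((R - (2 * n + 1) - (j + 1) : ℕ) : ℝ))))) := by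
    intro m
    induction m with
    | zero => intro _; simpa using hstep0
    | succ m IHm =>
      intro hm
      have h1 := IHm (by omega)
      have h2 := hstepm m (by omega)
      have esplit : ∀ η, ∫ σ, Hf (m + 1) σ ∂(γ Λ η) =
          ∫ σ, Hf m σ ∂(γ Λ η) + ∫ σ, (Hf (m + 1) σ - Hf m σ) ∂(γ Λ η) := fun η => by
        rw [integral_sub (hHi (m + 1) η) (hHi m η)]
        ring
      rw [esplit ζ, esplit ζ', Finset.sum_range_succ]
      calc |∫ σ, Hf m σ ∂(γ Λ ζ) + ∫ σ, (Hf (m + 1) σ - Hf m σ) ∂(γ Λ ζ) -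
            (∫ σ, Hf m σ ∂(γ Λ ζ') + ∫ σ, (Hf (m + 1) σ - Hf m σ) ∂(γ Λ ζ'))|
          = |(∫ σ, Hf m σ ∂(γ Λ ζ) - ∫ σ, Hf m σ ∂(γ Λ ζ')) +
              (∫ σ, (Hf (m + 1) σ - Hf m σ) ∂(γ Λ ζ) -
                ∫ σ, (Hf (m + 1) σ - Hf m σ) ∂(γ Λ ζ'))| := by ring_nf
        _ ≤ |∫ σ, Hf m σ ∂(γ Λ ζ) - ∫ σ, Hf m σ ∂(γ Λ ζ')| +
              |∫ σ, (Hf (m + 1) σ - Hf m σ) ∂(γ Λ ζ) -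
                ∫ σ, (Hf (m + 1) σ - Hf m σ) ∂(γ Λ ζ')| := abs_add_le _ _
        _ ≤ _ := by linarith [h1, h2]
  -- exponent bookkeeping
  have hcastM : ((R - (2 * n + 1) - 0 : ℕ) : ℝ) = (R : ℝ) - (2 * n + 1) := by
    rw [Nat.sub_zero, Nat.cast_sub hRsmall]; push_cast; ring
  have hΦM : E * Real.exp (-(κ * ((R - (2 * n + 1) - 0 : ℕ) : ℝ))) = E * B := by
    rw [hcastM, hB, hE, ← Real.exp_add, ← Real.exp_add, ← Real.exp_add]
    congr 1; ring
  have hterm : ∀ j, j < M → 2 * (Λl * Real.exp (-(r * j))) * ((Y (j + 1)).card *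
      (E * Real.exp (-(κ * ((R - (2 * n + 1) - (j + 1) : ℕ) : ℝ))))) ≤
      2 * Λl * E * Real.exp r * B *
        (((4 * n + 5 + 2 * j) ^ d : ℝ) * Real.exp (-((r - κ) * (j + 1)))) := by
    intro j hj
    have hcastj : ((R - (2 * n + 1) - (j + 1) : ℕ) : ℝ) = (R : ℝ) - (2 * n + 1) - (j + 1) := by
      have h1 : (2 * n + 1) + (j + 1) ≤ R := by omega
      rw [Nat.sub_sub, Nat.cast_sub h1]; push_cast; ring
    have hexp : Real.exp (-(r * j)) * Real.exp (-(κ * ((R - (2 * n + 1) - (j + 1) : ℕ) : ℝ))) =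
        Real.exp r * B * Real.exp (-((r - κ) * (j + 1))) := by
      rw [hcastj, hB, hE, ← Real.exp_add, ← Real.exp_add, ← Real.exp_add, ← Real.exp_add]
      congr 1; ring
    have hcard : ((Y (j + 1)).card : ℝ) ≤ ((4 * n + 5 + 2 * j) ^ d : ℝ) := by
      have h := hYcard (j + 1)
      have e : 4 * n + 3 + 2 * (j + 1) = 4 * n + 5 + 2 * j := by ring
      rw [e] at h
      exact_mod_cast h
    have hw : 0 ≤ Λl * Real.exp (-(r * j)) *
        (E * Real.exp (-(κ * ((R - (2 * n + 1) - (j + 1) : ℕ) : ℝ)))) := by positivity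
    calc 2 * (Λl * Real.exp (-(r * j))) * ((Y (j + 1)).card *
          (E * Real.exp (-(κ * ((R - (2 * n + 1) - (j + 1) : ℕ) : ℝ)))))
        = 2 * (Y (j + 1)).card * (Λl * Real.exp (-(r * j)) *
            (E * Real.exp (-(κ * ((R - (2 * n + 1) - (j + 1) : ℕ) : ℝ))))) := by ring
      _ ≤ 2 * ((4 * n + 5 + 2 * j) ^ d : ℝ) * (Λl * Real.exp (-(r * j)) *
            (E * Real.exp (-(κ * ((R - (2 * n + 1) - (j + 1) : ℕ) : ℝ))))) := by gcongr
      _ = 2 * Λl * E * ((4 * n + 5 + 2 * j) ^ d : ℝ) * (Real.exp (-(r * j)) *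
            Real.exp (-(κ * ((R - (2 * n + 1) - (j + 1) : ℕ) : ℝ)))) := by ring
      _ = _ := by rw [hexp]; ring
  have hsum : ∑ j ∈ Finset.range M, 2 * (Λl * Real.exp (-(r * j))) * ((Y (j + 1)).card *
      (E * Real.exp (-(κ * ((R - (2 * n + 1) - (j + 1) : ℕ) : ℝ))))) ≤
      2 * Λl * E * Real.exp r * B * K := by
    calc _ ≤ ∑ j ∈ Finset.range M, 2 * Λl * E * Real.exp r * B *
          (((4 * n + 5 + 2 * j) ^ d : ℝ) * Real.exp (-((r - κ) * (j + 1)))) :=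
          Finset.sum_le_sum fun j hj => hterm j (Finset.mem_range.1 hj)
      _ = 2 * Λl * E * Real.exp r * B * ∑ j ∈ Finset.range M,
          (((4 * n + 5 + 2 * j) ^ d : ℝ) * Real.exp (-((r - κ) * (j + 1)))) := by
          rw [Finset.mul_sum]
      _ ≤ 2 * Λl * E * Real.exp r * B * K := by
          have h0 : 0 ≤ 2 * Λl * E * Real.exp r * B := by positivity
          exact mul_le_mul_of_nonneg_left (hK M) h0
  have htailB : Λl * Real.exp (-(r * M)) ≤ Λl * B := by
    refine mul_le_mul_of_nonneg_left ?_ hΛl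
    rw [hB, hE, ← Real.exp_add, Real.exp_le_exp]
    have hMc : ((M : ℕ) : ℝ) = (R : ℝ) - (2 * n + 1) := by
      rw [hM, Nat.cast_sub hRsmall]; push_cast; ring
    have hM0 : (0 : ℝ) ≤ M := Nat.cast_nonneg M
    nlinarith [hMc, hM0, hκr, hκ]
  -- assemble
  have hMζ : ∀ v, v ∉ Λ → cdist x (cell v) ≤ 2 * n + 1 + M → ζ v = ζ v := fun _ _ _ => rfl
  have hMζ' : ∀ v, v ∉ Λ → cdist x (cell v) ≤ 2 * n + 1 + M → ζ' v = ζ v :=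
    fun v hv hd => (hagree v hv (by omega)).symm
  have hB0 : 0 ≤ B := by positivity
  calc |∫ σ, g σ ∂(γ Λ ζ) - ∫ σ, g σ ∂(γ Λ ζ')|
      ≤ |∫ σ, g σ ∂(γ Λ ζ) - ∫ σ, Hf M σ ∂(γ Λ ζ)| +
          |∫ σ, Hf M σ ∂(γ Λ ζ) - ∫ σ, Hf M σ ∂(γ Λ ζ')| +
          |∫ σ, Hf M σ ∂(γ Λ ζ') - ∫ σ, g σ ∂(γ Λ ζ')| := by
        have := abs_sub_le (∫ σ, g σ ∂(γ Λ ζ)) (∫ σ, Hf M σ ∂(γ Λ ζ)) (∫ σ, g σ ∂(γ Λ ζ'))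
        have := abs_sub_le (∫ σ, Hf M σ ∂(γ Λ ζ)) (∫ σ, Hf M σ ∂(γ Λ ζ')) (∫ σ, g σ ∂(γ Λ ζ'))
        linarith
    _ ≤ Λl * B + (ε * shellCount d n * (E * B) + 2 * Λl * E * Real.exp r * B * K) + Λl * B := by
        refine add_le_add (add_le_add ((houter ζ hMζ).trans htailB) ?_) ?_
        · have h := htele M le_rfl
          rw [hΦM] at h
          linarith [hsum]
        · rw [abs_sub_comm]
          exact (houter ζ' hMζ').trans htailB
    _ = (E * (ε * shellCount d n + 2 * Λl * Real.exp r * K) + 2 * Λl) * B := by ring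
    _ ≤ 1 * B := mul_le_mul_of_nonneg_right hsub hB0
    _ = E * Real.exp (-(κ * R)) := by rw [one_mul]


end Literature.Probability.LatticeModels
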